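import Summits.BirchSwinnertonDyer.BirchSwinnertonDyer.Theses.TameQuarticManinParity
import Literature.NumberTheory.EllipticCurves.NewformCuspFourierValuationRepresentative
import HarnessLib

/-!
# Route `TameQuarticManinParity`, support item S50 `FourierCoeffAtCuspLinear` (stmt-BirchSwinnertonDyer-23719), PROVED BY NAME

The Fourier coefficients `a_f(n; γ)` at the cusp `γ∞` of `Γ₀(N)` (tree `fourierCoeffAtCusp N k f γ n =
(qExpansion w (f ∣[k] γ)).coeff n`, `w = w(γ∞)` the cusp width, [ČNS §4.2]) are ADDITIVE and HOMOGENEOUS in the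
weight-2 cusp form `f ∈ S₂(Γ₀(N))`.  Proof (pure API, as planned on the route and in the refuter's briefing of
2026-08-29): `⇑(f + g) ∣[2] γ = ⇑f ∣[2] γ + ⇑g ∣[2] γ`, `⇑(c • f) ∣[2] γ = c • (⇑f ∣[2] γ)` (Mathlib
`SlashAction.add_slash`, `ModularForm.SL_smul_slash`, `CuspForm.IsGLPos.coe_smul`); the cusp functions of `⇑f ∣[2] γ`, `⇑g ∣[2] γ` in the
parameter `e^{2πiz/w}` are ANALYTIC at `0` because `⇑f ∣[2] γ = ⇑(ModularForm.translate f γ)` is a modular form for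
`γ⁻¹Γ₀(N)γ`, of which `w` is a strict period (tree `cuspWidth_mem_strictPeriods`; Mathlib
`ModularFormClass.analyticAt_cuspFunction_zero`), so Mathlib's `qExpansion_add` / `qExpansion_smul` apply — no junk
branch of `Function.Periodic.cuspFunction` is hit.  Proved for every weight `k` and every `ModularFormClass`
(`fourierCoeffAtCusp_add`, `fourierCoeffAtCusp_smul`), then specialised to the item's literal statement
(`fourierCoeffAtCuspLinear : FourierCoeffAtCuspLinear`).

BSD is NOT proved by this; the route's cruxes R50a `MiddleResidueRankBound`, R50b `TwistedOldformResidueBasis` and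
RL47 `CuspRegularResidueLaw` stay OPEN; this closes only the API support binder S50 of the LINE-50 glue
(stmt-BirchSwinnertonDyer-23766).  THEOREMS ONLY.  Axioms `propext`, `Classical.choice`, `Quot.sound`.
-/

set_option autoImplicit false
-- D-0017: single-problem summit, so `Summit.BirchSwinnertonDyer.BirchSwinnertonDyer.…` repeats a namespace BY DESIGN.
set_option linter.dupNamespace false

noncomputable section

namespace Summit.BirchSwinnertonDyer.BirchSwinnertonDyer.Theorems.TameQuarticManinParity

open scoped MatrixGroups ModularForm Pointwise
open UpperHalfPlane hiding I
open CongruenceSubgroup Matrix.SpecialLinearGroup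
open Summit.BirchSwinnertonDyer.BirchSwinnertonDyer.Theses.TameQuarticManinParity
open Literature.NumberTheory.EllipticCurves.ModularForms
open Literature.NumberTheory.Automorphic (Fuchsian.cuspWidth Fuchsian.cuspWidth_pos)

/-- The cusp function of `f ∣[k] γ` in the parameter `e^{2πiz/w}`, `w = w(γ∞)` the width of the cusp `γ∞` of
`Γ₀(N)`, is analytic at `0`, for every modular form `f` of weight `k` on `Γ₀(N)` and every `γ ∈ SL₂(ℤ)`:
`f ∣[k] γ` is a modular form for `γ⁻¹Γ₀(N)γ` (Mathlib `ModularForm.translate`) and `w` is a strict period of that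
group (tree `cuspWidth_mem_strictPeriods`). [cite: CesnaviciusNeururerSaha2023, §4.2 (4.2.1)] -/
theorem analyticAt_cuspFunction_slash (N : ℕ) [NeZero N] (k : ℤ) {F : Type*} [FunLike F ℍ ℂ]
    [ModularFormClass F (Gamma0 N) k] (f : F) (γ : SL(2, ℤ)) :
    AnalyticAt ℂ (cuspFunction (Fuchsian.cuspWidth N (γ 1 0) : ℝ) (⇑f ∣[k] γ)) 0 := by
  have hw : (0 : ℝ) < (Fuchsian.cuspWidth N (γ 1 0) : ℝ) := by
    exact_mod_cast Fuchsian.cuspWidth_pos N (γ 1 0)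
  have hΓ := cuspWidth_mem_strictPeriods N γ
  have h := ModularFormClass.analyticAt_cuspFunction_zero (ModularForm.translate f (mapGL ℝ γ)) hw hΓ
  have hcoe : ⇑(ModularForm.translate f (mapGL ℝ γ)) = ⇑f ∣[k] γ := rfl
  rwa [hcoe] at h

/-- **Additivity of the Fourier coefficients at a cusp**: `a_{f+g}(n; γ) = a_f(n; γ) + a_g(n; γ)` for modular
forms `f, g` of weight `k` on `Γ₀(N)` (as functions), every `γ ∈ SL₂(ℤ)` and every `n`.
[cite: CesnaviciusNeururerSaha2023, §4.2 (4.2.1)] -/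
theorem fourierCoeffAtCusp_add (N : ℕ) [NeZero N] (k : ℤ) {F G : Type*} [FunLike F ℍ ℂ] [FunLike G ℍ ℂ]
    [ModularFormClass F (Gamma0 N) k] [ModularFormClass G (Gamma0 N) k] (f : F) (g : G) (γ : SL(2, ℤ)) (n : ℕ) :
    fourierCoeffAtCusp N k (⇑f + ⇑g) γ n = fourierCoeffAtCusp N k ⇑f γ n + fourierCoeffAtCusp N k ⇑g γ n := by
  unfold fourierCoeffAtCusp
  rw [SlashAction.add_slash, qExpansion_add (analyticAt_cuspFunction_slash N k f γ)
    (analyticAt_cuspFunction_slash N k g γ), map_add]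

/-- **Homogeneity of the Fourier coefficients at a cusp**: `a_{c f}(n; γ) = c · a_f(n; γ)` for a modular form `f`
of weight `k` on `Γ₀(N)`, `c ∈ ℂ`, every `γ ∈ SL₂(ℤ)` and every `n`. [cite: CesnaviciusNeururerSaha2023, §4.2 (4.2.1)] -/
theorem fourierCoeffAtCusp_smul (N : ℕ) [NeZero N] (k : ℤ) {F : Type*} [FunLike F ℍ ℂ]
    [ModularFormClass F (Gamma0 N) k] (c : ℂ) (f : F) (γ : SL(2, ℤ)) (n : ℕ) :
    fourierCoeffAtCusp N k (c • ⇑f) γ n = c * fourierCoeffAtCusp N k ⇑f γ n := by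
  unfold fourierCoeffAtCusp
  rw [ModularForm.SL_smul_slash, qExpansion_smul (analyticAt_cuspFunction_slash N k f γ), map_smul, smul_eq_mul]

/-- **S50 `FourierCoeffAtCuspLinear` BY NAME** (route `TameQuarticManinParity`, support item
stmt-BirchSwinnertonDyer-23719): the cusp Fourier coefficients of weight-2 cusp forms on `Γ₀(N)` are additive and
homogeneous. [cite: CesnaviciusNeururerSaha2023, §4.2 (4.2.1)] -/
theorem fourierCoeffAtCuspLinear : FourierCoeffAtCuspLinear := by
  intro N _ f g c γ n
  refine ⟨?_, ?_⟩
  · rw [CuspForm.coe_add]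
    exact fourierCoeffAtCusp_add N 2 f g γ n
  · rw [CuspForm.IsGLPos.coe_smul]
    exact fourierCoeffAtCusp_smul N 2 c f γ n

end Summit.BirchSwinnertonDyer.BirchSwinnertonDyer.Theorems.TameQuarticManinParity

end
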